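import Literature.Probability.FitznerVanDerHofstad2017.Stage1EvalRec
import Literature.Probability.FitznerVanDerHofstad2017.Stage1CellsU
import HarnessLib

/-!
# Literature.Probability.FitznerVanDerHofstad2017.Stage1EvalU — stage 1 on the DERIVABLE-MULTIPLICITY cells of record (`Rec.U`), real and rational

CITATION HEADER (PLACEMENT v2). Part of the certified REPRODUCTION of R. Fitzner, R. van der Hofstad, *Mean-field
behavior for nearest-neighbor percolation in d > 10*, EJP 22 (2017) no. 43 [FvdH17] (notebook `Percolation.nb`) and
*Generalized approach to the non-backtracking lace expansion*, PTRF 169 (2017) 1041–1119 [NoBLE17]; build `lace`, seat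
lean2 (gen 13), LEMMAS §21 node N72(b) TRANCHE 2a.  ADDITIVE companion of `Stage1EvalRec.lean` (lean2-g12): nothing there,
in `Stage1Frame` / `Stage1Eval` / `Stage1Cells*` or in any record file is changed; no numeral of the notebooks, no table,
no verdict; nothing here is a cited fact.

WHAT THIS MODULE IS.  The text of `Stage1EvalRec.lean` (sha256 f5a526a3768c735e…) transformed MECHANICALLY (generator
`lean2/g13/utwin/gen_eval_u.py`): every cell of the cell-44 record that lies in the repulsive-polygon closure (the 64 cells
of `Stage1CellsU.lean`, sha256 c83bd17599128b45…: `Rec.XiR1D` ↦ `Rec.U.XiR1D`, coded `XiAbs` ↦ `Rec.U.XiAbs`, …; 28 of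
the sixty fields) is re-pointed to its `Stage1Cells.Rec.U` namesake, the declared names get the suffix `U`
(`Data.inpRecU`, `Data.stage1RecU`, `Data.frameRecU`, `Std.monoRecU`, `Std.nonnegRecU`, `Std.hypRecU`, `DataQ.inpRrecU`,
`Data.inpRecU_ratCast`, `Data.inpRecU_dom_of_ratModel`, `Data.dom_inpRecU_of_ratModel`), and the shared pieces (`K2rec`,
`piAlphaLower0Rec` with the printed hexagon exponent, their `ℚ` mirrors and cast lemmas) are the ones of `Stage1EvalRec`.
Hence `D.inpRecU y s` is cell 44 (tail-free variant `T″₀`) over the polygons with the DERIVABLE multiplicities of LEMMAS §21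
(closed Triangle one-tail / Square two-tail `C(n+1,2)`; additive open cells) AND the weighted bubble of record AND the
printed hexagon exponent — the typed text of the engines' record class `U` on the cell of record — with the same `Std`
theorems (monotonicity, structural signs, the no-go frame hypotheses) proved by the same generic proofs, and
`E.inpRrecU P y s` is its rational mirror with `D.inpRecU y.cast s = E.inpRrecU D.P y s` under `D.RatModel E`.

WHY (GAPS 'lean2 gen 13 — AMENDMENT 2').  The (S2a′) hypotheses of the App.-D line are to be re-based on THIS record
(tranche 2b: the `N ≥ 4` tails over `Rec.U`, the `d = 11` dominations `inpMaj…U(record) .Dom D11.inputsO / D11.inputsI2`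
decided in the kernel, module 2b), because the printed derivation delivers the `U` class, not the coded one.

[cite: FitznerVanDerHofstad2016NoBLE, §5.3 (5.40)–(5.42), §5.3.3 and §5.3.2 (5.9) (PTRF 169 pp. 1096–1100)]
[cite: FitznerVanDerHofstad2017, notebook Percolation.nb cell 44 (transcript l.1214–1237)]
-/

namespace Literature.Probability.FitznerVanDerHofstad2017
namespace Stage1Cells

open NoGoFrame F3Bounds BetaMap PX

/-! ## The real side: cell 44 / stage 1 / frame over the `Rec.U` cells (`K₂rec`, `piAlphaLower0Rec` shared with `Stage1EvalRec`) -/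

namespace Data

variable {ν : Type*} (D : Data ν)

/-- Cell 44 (l.1214–1237) ON THE DERIVABLE-MULTIPLICITY CELLS OF RECORD (`Rec.U`): the sixty App. D inputs at point `s` and state `y`, field ↦ `Bound` key
exactly as `Data.inp` (tail-free variant `T″₀`), the 22 `Δ`-fields over `Stage1Cells.Rec.U` (LEMMAS §21 derivable polygon multiplicities on top of D46 `wborbx` + D34 `wbg2`) and
`piAlphaLower` with the printed exponent (D49 `hexprint`). [cite: FitznerVanDerHofstad2017, notebook Percolation.nb cell 44 (transcript l.1214–1237)] -/
noncomputable def inpRecU (y : State) (s : Pt) : Inputs where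
  mu := y.m
  muMin := D.muMin s y
  mubOverMu := D.ev s y mubOverMu
  mub := D.ev s y z
  xiAlphaOneMinusZeroAtZero := 0
  xiAlphaZeroMinusOneAtZero := 0
  xiAlphaOneMinusZeroAtEi := D.ev s y (XiAlpha10 D.P)
  xiAlphaZeroMinusOneAtEi := D.ev s y (XiAlpha01 D.P)
  xiIotaAlphaIAtEi := D.ev s y (XiIotaAlphaI0 D.P)
  xiIotaAlphaIIAtZero := D.ev s y XiIotaAlphaII0
  xiIotaAlphaISumAroundEi := D.ev s y (XiIotaAlphaISum D.P)
  xiIotaAlphaIISumAroundZero := D.ev s y (XiIotaAlphaIISum D.P)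
  psiAlphaIOneMinusZeroAroundEi := D.ev s y (PsiAlphaI10 D.P)
  psiAlphaIIZeroMinusOneAroundZero := D.psiAlphaII01 s y
  psiAlphaIZeroMinusOneAroundEi := D.psiAlphaI01 s y
  psiAlphaIIOneMinusZeroAroundZero := D.ev s y (PsiAlphaII10 D.P)
  piAlpha := D.ev s y (PiAlpha0 D.P)
  piAlphaLower := D.piAlphaLower0Rec s y
  piOneLower := D.pi1Lower s y
  psiZeroLower := D.psiLower0 s y
  xiAbs := D.ev s y (Rec.U.XiAbs D.P)
  xiOdd := D.ev s y (Rec.U.XiOdd D.P)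
  xiEven := D.ev s y (Rec.U.XiEven D.P)
  xiEvenTail := D.ev s y (Rec.U.Xi2 D.P)
  xiOddTail := D.ev s y (Rec.U.Xi3 D.P)
  xiR0 := D.ev s y (XiR0 D.P)
  xiR1 := D.ev s y (Rec.U.XiR1 D.P)
  xiR0Delta := D.ev s y (Rec.XiR0D D.P)
  xiR1Delta := D.ev s y (Rec.U.XiR1D D.P)
  xiDeltaAbs := D.ev s y (Rec.U.XiAbsD D.P)
  xiOddDelta := D.ev s y (Rec.U.XiOddD D.P)
  xiEvenDelta := D.ev s y (Rec.U.XiEvenD D.P)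
  xiOddTailDelta := D.ev s y (Rec.U.Xi3D D.P)
  xiEvenTailDelta := D.ev s y (Rec.U.Xi2D D.P)
  psiRI0 := D.ev s y (PsiRI0 D.P)
  psiRI1 := D.ev s y (Rec.U.PsiRI1 D.P)
  psiRII0 := D.ev s y (PsiRII0 D.P)
  psiRII1 := D.ev s y (Rec.U.PsiRII1 D.P)
  psiRI0Delta := D.ev s y (Rec.PsiRI0D D.P)
  psiRI1Delta := D.ev s y (Rec.U.PsiRI1D D.P)
  psiRII0Delta := D.ev s y (Rec.PsiRII0D D.P)
  psiRII1Delta := D.ev s y (Rec.U.PsiRII1D D.P)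
  piR0 := D.ev s y (PiR0 D.P)
  piR0DeltaEiEk := D.ev s y (Rec.PiR0D D.P)
  xiIotaAbs := D.ev s y (Rec.U.XiIotaAbs D.P)
  xiIotaOdd := D.ev s y (Rec.U.XiIotaOdd D.P)
  xiIotaEven := D.ev s y (Rec.U.XiIotaEven D.P)
  xiIotaEvenTail := D.ev s y (Rec.U.XiIota2 D.P)
  xiIotaRI0 := D.ev s y (XiIotaRI0 D.P)
  xiIotaRII0 := D.ev s y (XiIotaRII0 D.P)
  xiIotaDeltaEi := D.ev s y (Rec.U.XiIotaAbsDei D.P)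
  xiIotaOddDeltaEi := D.ev s y (Rec.U.XiIotaOddDei D.P)
  xiIotaEvenDeltaEi := D.ev s y (Rec.U.XiIotaEvenDei D.P)
  xiIotaEvenTailDeltaEi := D.ev s y (Rec.U.XiIota2Dei D.P)
  xiIotaDeltaZero := D.ev s y (Rec.U.XiIotaAbsD0 D.P)
  xiIotaOddDeltaZero := D.ev s y (Rec.U.XiIotaOddD0 D.P)
  xiIotaEvenDeltaZero := D.ev s y (Rec.U.XiIotaEvenD0 D.P)
  xiIotaEvenTailDeltaZero := D.ev s y (Rec.U.XiIota2D0 D.P)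
  xiIotaRI0DeltaEi := D.ev s y (Rec.XiIotaRI0Dei D.P)
  xiIotaRII0DeltaZero := D.ev s y (Rec.XiIotaRII0D0 D.P)

/-- STAGE 1 of the typed frame ON THE DERIVABLE-MULTIPLICITY CELLS OF RECORD (`Rec.U`) (the three two-point bounds are the coded cells 5, 6, 8, unchanged).
[cite: FitznerVanDerHofstad2017, notebook Percolation.nb cells 3–44] -/
noncomputable def stage1RecU (y : State) : Stage1 where
  inp := D.inpRecU y
  G11 := D.ev .o y (G1 D.P 1)
  G22 := D.ev .o y (G2 D.P 2)
  G012 := D.ev .o y (G01 D.P 2)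

/-- THE TYPED FRAME ON THE DERIVABLE-MULTIPLICITY CELLS OF RECORD (`Rec.U`): `Data.frame` with `S := D.stage1RecU` (validity region `D.U`, initial cells,
`τ`, `n₀ … n₀₀₁` unchanged). [cite: FitznerVanDerHofstad2017, notebook Percolation.nb cells 2–54] -/
noncomputable def frameRecU : Frame ν where
  d := D.dR
  τ := D.τ
  hasT203 := D.hasT203
  codedD20 := D.codedD20
  codedD31 := D.codedD31
  codedD33 := D.codedD33
  printedD36 := D.printedD36
  n0 := D.n0
  n1 := D.n1
  n2 := D.n2
  n3 := D.n3
  n01 := D.n01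
  n11 := D.n11
  n001 := D.n001
  S := D.stage1RecU
  U := D.U

/-- The `U` record frame's initial cells are `D.initCell`. [folklore] -/
theorem frameRecU_initCell : D.frameRecU.initCell = D.initCell := rfl

/-- Cell 44: `mu[s] = m` on the `U` record frame. [folklore] -/
theorem mu_eq_recU (y : State) (s : Pt) : ((D.frameRecU.S y).inp s).mu = y.m := rfl

/-- the `U` record frame has the validity region of the coded one. [folklore] -/
theorem frameRecU_U : D.frameRecU.U = D.frame.U := rfl

end Data

/-! ## The `Std` theorems for the `U` record frame (proofs verbatim from `Stage1Frame`) -/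

namespace Data

variable {ν : Type*} {D : Data ν} {y₀ x y : State}

section Val
variable (H : D.Std y₀)
include H

/-- STAGE 1 ON THE DERIVABLE-MULTIPLICITY CELLS OF RECORD (`Rec.U`) IS MONOTONE (`Frame.Hyp.mono` for `frameRecU`). [folklore] -/
theorem Std.monoRecU (hx : y₀ ≤ x) (hxy : x ≤ y) (hU : D.U y) : (D.stage1RecU x).Dom (D.stage1RecU y) := by
  have E := fun s e => H.ev_mono hx hxy hU s e
  refine ⟨fun s => ?_, E .o _, E .o _, E .o _⟩
  constructor
  all_goals first
    | exact E s _
    | exact hxy.2.1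
    | exact H.muMin_anti hx hxy s
    | exact H.piAlphaLower0Rec_anti hx hxy hU s
    | exact H.pi1Lower_anti hx hxy hU s
    | exact H.psiLower0_anti hx hxy hU s
    | exact H.psiAlphaI01_mono hx hxy hU s
    | exact H.psiAlphaII01_mono hx hxy hU s
    | exact le_rfl

/-- STAGE 1 ON THE DERIVABLE-MULTIPLICITY CELLS OF RECORD (`Rec.U`) HAS THE STRUCTURAL SIGNS on `U` (`Frame.Hyp.nonneg` for `frameRecU`). [folklore] -/
theorem Std.nonnegRecU (hy : y₀ ≤ y) (hU : D.U y) : (D.stage1RecU y).Nonneg := by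
  have E := fun s e => H.ev_nonneg hy hU s e
  refine ⟨fun s => ?_, E .o _, E .o _, E .o _⟩
  constructor
  all_goals first
    | exact E s _
    | exact H.muMin_lt_one hy s
    | exact H.psiAlphaI01_nonneg hy hU s
    | exact H.psiAlphaII01_nonneg hy hU s
    | exact le_rfl

/-- THE STAGE-1 HYPOTHESES OF THE NO-GO THEOREM FOR THE RECORD FRAME: as `Std.hyp`, every field of
`NoGoFrame.Frame.Hyp y₀` except the floor sign checks is a theorem. [folklore] -/
theorem Std.hypRecU (hm : 0 ≤ y₀.m) (hPi : ∀ s, 0 ≤ 1 + (D.frameRecU.betaAt y₀ s).βPi) : D.frameRecU.Hyp y₀ where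
  two_le_d := H.two_le_dR
  tables := H.τ_nonneg
  U_down := fun _ _ hx hxy hU => H.U_down hx hxy hU
  mono := fun _ _ hx hxy hU => H.monoRecU hx hxy hU
  nonneg := fun _ hy hU => H.nonnegRecU hy hU
  mu_eq := fun _ _ _ => rfl
  m_floor := hm
  Gamma1_floor := zero_le_one.trans H.one_le_Gamma1
  Gamma2_floor := zero_le_one.trans H.one_le_Gamma2
  onePlusPi_floor := hPi

end Val

end Data

/-! ## The rational side (verbatim over `ℚ`) and the cast lemmas -/

namespace DataQ

variable (E : DataQ) (P : Params)

/-- Cell 44 ON THE DERIVABLE-MULTIPLICITY CELLS OF RECORD (`Rec.U`) at rational data, as a real record whose sixty entries are casts of rationals (field ↦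
cell exactly as `Data.inpRecU`). [cite: FitznerVanDerHofstad2017, notebook Percolation.nb cell 44 (transcript l.1214–1237)] -/
noncomputable def inpRrecU (y : StateQ) (s : Pt) : Inputs where
  mu := ((y.m : ℚ) : ℝ)
  muMin := ((E.muMin P s y : ℚ) : ℝ)
  mubOverMu := ((E.ev P s y mubOverMu : ℚ) : ℝ)
  mub := ((E.ev P s y z : ℚ) : ℝ)
  xiAlphaOneMinusZeroAtZero := 0
  xiAlphaZeroMinusOneAtZero := 0
  xiAlphaOneMinusZeroAtEi := ((E.ev P s y (XiAlpha10 P) : ℚ) : ℝ)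
  xiAlphaZeroMinusOneAtEi := ((E.ev P s y (XiAlpha01 P) : ℚ) : ℝ)
  xiIotaAlphaIAtEi := ((E.ev P s y (XiIotaAlphaI0 P) : ℚ) : ℝ)
  xiIotaAlphaIIAtZero := ((E.ev P s y XiIotaAlphaII0 : ℚ) : ℝ)
  xiIotaAlphaISumAroundEi := ((E.ev P s y (XiIotaAlphaISum P) : ℚ) : ℝ)
  xiIotaAlphaIISumAroundZero := ((E.ev P s y (XiIotaAlphaIISum P) : ℚ) : ℝ)
  psiAlphaIOneMinusZeroAroundEi := ((E.ev P s y (PsiAlphaI10 P) : ℚ) : ℝ)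
  psiAlphaIIZeroMinusOneAroundZero := ((E.psiAlphaII01 P s y : ℚ) : ℝ)
  psiAlphaIZeroMinusOneAroundEi := ((E.psiAlphaI01 P s y : ℚ) : ℝ)
  psiAlphaIIOneMinusZeroAroundZero := ((E.ev P s y (PsiAlphaII10 P) : ℚ) : ℝ)
  piAlpha := ((E.ev P s y (PiAlpha0 P) : ℚ) : ℝ)
  piAlphaLower := ((E.piAlphaLower0Rec P s y : ℚ) : ℝ)
  piOneLower := ((E.pi1Lower P s y : ℚ) : ℝ)
  psiZeroLower := ((E.psiLower0 P s y : ℚ) : ℝ)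
  xiAbs := ((E.ev P s y (Rec.U.XiAbs P) : ℚ) : ℝ)
  xiOdd := ((E.ev P s y (Rec.U.XiOdd P) : ℚ) : ℝ)
  xiEven := ((E.ev P s y (Rec.U.XiEven P) : ℚ) : ℝ)
  xiEvenTail := ((E.ev P s y (Rec.U.Xi2 P) : ℚ) : ℝ)
  xiOddTail := ((E.ev P s y (Rec.U.Xi3 P) : ℚ) : ℝ)
  xiR0 := ((E.ev P s y (XiR0 P) : ℚ) : ℝ)
  xiR1 := ((E.ev P s y (Rec.U.XiR1 P) : ℚ) : ℝ)
  xiR0Delta := ((E.ev P s y (Rec.XiR0D P) : ℚ) : ℝ)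
  xiR1Delta := ((E.ev P s y (Rec.U.XiR1D P) : ℚ) : ℝ)
  xiDeltaAbs := ((E.ev P s y (Rec.U.XiAbsD P) : ℚ) : ℝ)
  xiOddDelta := ((E.ev P s y (Rec.U.XiOddD P) : ℚ) : ℝ)
  xiEvenDelta := ((E.ev P s y (Rec.U.XiEvenD P) : ℚ) : ℝ)
  xiOddTailDelta := ((E.ev P s y (Rec.U.Xi3D P) : ℚ) : ℝ)
  xiEvenTailDelta := ((E.ev P s y (Rec.U.Xi2D P) : ℚ) : ℝ)
  psiRI0 := ((E.ev P s y (PsiRI0 P) : ℚ) : ℝ)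
  psiRI1 := ((E.ev P s y (Rec.U.PsiRI1 P) : ℚ) : ℝ)
  psiRII0 := ((E.ev P s y (PsiRII0 P) : ℚ) : ℝ)
  psiRII1 := ((E.ev P s y (Rec.U.PsiRII1 P) : ℚ) : ℝ)
  psiRI0Delta := ((E.ev P s y (Rec.PsiRI0D P) : ℚ) : ℝ)
  psiRI1Delta := ((E.ev P s y (Rec.U.PsiRI1D P) : ℚ) : ℝ)
  psiRII0Delta := ((E.ev P s y (Rec.PsiRII0D P) : ℚ) : ℝ)
  psiRII1Delta := ((E.ev P s y (Rec.U.PsiRII1D P) : ℚ) : ℝ)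
  piR0 := ((E.ev P s y (PiR0 P) : ℚ) : ℝ)
  piR0DeltaEiEk := ((E.ev P s y (Rec.PiR0D P) : ℚ) : ℝ)
  xiIotaAbs := ((E.ev P s y (Rec.U.XiIotaAbs P) : ℚ) : ℝ)
  xiIotaOdd := ((E.ev P s y (Rec.U.XiIotaOdd P) : ℚ) : ℝ)
  xiIotaEven := ((E.ev P s y (Rec.U.XiIotaEven P) : ℚ) : ℝ)
  xiIotaEvenTail := ((E.ev P s y (Rec.U.XiIota2 P) : ℚ) : ℝ)
  xiIotaRI0 := ((E.ev P s y (XiIotaRI0 P) : ℚ) : ℝ)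
  xiIotaRII0 := ((E.ev P s y (XiIotaRII0 P) : ℚ) : ℝ)
  xiIotaDeltaEi := ((E.ev P s y (Rec.U.XiIotaAbsDei P) : ℚ) : ℝ)
  xiIotaOddDeltaEi := ((E.ev P s y (Rec.U.XiIotaOddDei P) : ℚ) : ℝ)
  xiIotaEvenDeltaEi := ((E.ev P s y (Rec.U.XiIotaEvenDei P) : ℚ) : ℝ)
  xiIotaEvenTailDeltaEi := ((E.ev P s y (Rec.U.XiIota2Dei P) : ℚ) : ℝ)
  xiIotaDeltaZero := ((E.ev P s y (Rec.U.XiIotaAbsD0 P) : ℚ) : ℝ)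
  xiIotaOddDeltaZero := ((E.ev P s y (Rec.U.XiIotaOddD0 P) : ℚ) : ℝ)
  xiIotaEvenDeltaZero := ((E.ev P s y (Rec.U.XiIotaEvenD0 P) : ℚ) : ℝ)
  xiIotaEvenTailDeltaZero := ((E.ev P s y (Rec.U.XiIota2D0 P) : ℚ) : ℝ)
  xiIotaRI0DeltaEi := ((E.ev P s y (Rec.XiIotaRI0Dei P) : ℚ) : ℝ)
  xiIotaRII0DeltaZero := ((E.ev P s y (Rec.XiIotaRII0D0 P) : ℚ) : ℝ)

end DataQ

namespace Data

variable {ν : Type*} {D : Data ν} {E : DataQ} (h : D.RatModel E)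
include h

/-- CELL 44 ON THE DERIVABLE-MULTIPLICITY CELLS OF RECORD (`Rec.U`) AT RATIONAL DATA: field by field the cast of its rational value. [folklore] -/
theorem inpRecU_ratCast (y : StateQ) (s : Pt) : D.inpRecU y.cast s = E.inpRrecU D.P y s := by
  simp only [Data.inpRecU, DataQ.inpRrecU, ev_ratCast h, muMin_ratCast h, piAlphaLower0Rec_ratCast h, psiLower0_ratCast h,
    pi1Lower_ratCast h, psiAlphaI01_ratCast h, psiAlphaII01_ratCast h, StateQ.cast_m]

/-- kernel form of an upper comparison for the `U` record-cell stage 1. [folklore] -/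
theorem inpRecU_dom_of_ratModel {y : StateQ} {s : Pt} {N : Inputs} (hN : (E.inpRrecU D.P y s).Dom N) :
    (D.inpRecU y.cast s).Dom N := by
  rw [inpRecU_ratCast h]; exact hN

/-- kernel form of a lower comparison for the `U` record-cell stage 1. [folklore] -/
theorem dom_inpRecU_of_ratModel {y : StateQ} {s : Pt} {N : Inputs} (hN : N.Dom (E.inpRrecU D.P y s)) :
    N.Dom (D.inpRecU y.cast s) := by
  rw [inpRecU_ratCast h]; exact hN

end Data

end Stage1Cells
end Literature.Probability.FitznerVanDerHofstad2017
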